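import Mathlib
import HarnessLib
import HarnessLib.Audit
import Summits.QuantumFields.Statement

/-!
Route: RandomConstraintAnnealing

DORMANT since 2026-09-03T10:18:48Z (reconciler: no traction for 5 d (last activity statement-checked at 2026-08-29T09:15:22Z); parked, not closed — `ledger route dormant route-QuantumFields-RandomConstraintAnnealing --off` to reactivate) — unstaffed, not closed; items shared with open routes are served there. `ledger route dormant <id> --off` reactivates.

# Route RandomConstraintAnnealing — Wilson = annealed Haar-on-a-tube — the Edwards–Sokal threshold
law splits the 4D lattice gap exactly into a quenched tube gap and a threshold decorrelation

It suffices to show X = TubeGapLatticeLeg: for every compact simple G and every faithful unitary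
lattice representation r there are a
coupling floor β₀, a rate m(β) > 0 and a volume floor S₀(β) such that for every pair A, B of
gauge-invariant local lattice observables ONE
constant C gives |⟨A·τ_nB⟩ − ⟨A⟩⟨B⟩| ≤ C e^(−m(β) n) under Wilson's measure on every torus of side
2S+1 with S ≥ S₀(β), all n ≤ S, at every
β ≥ β₀ — the volume-uniform lattice mass gap at all weak couplings, in exactly the shape
`HasLatticeMassGap` consumes (C uniform in β).
The line reaches X through the card random-constraint-annealed-topological-action: slicing e^(βP_p)
= ∫_(c<P_p) βe^(βc) dc makes Wilson(β)
the U-marginal of a nearest-neighbour joint law on (U, c) whose U-conditional is HAAR CONDITIONED ON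
THE TUBE Ω_c = {P_p > c_p ∀p} and whose
threshold marginal ρ_β ∝ (∏ βe^(βc_p))·Haar(Ω_c) dc is the FK-type tilted law; the law of total
covariance then splits every Wilson covariance
EXACTLY into a quenched part (crux QuenchedTubeGapInMean) and an annealed part (crux
ThresholdDecorrelation), with a provable glue.
X feeds the summit through LatticeGapToClay (the UV / Osterwalder–Schrader legs, shared with every
lattice-first line).
Lean: `∀ (G : Type) [Group G] [TopologicalSpace G] [IsTopologicalGroup G] [CompactSpace G],
Literature.MathematicalPhysics.QuantumFieldTheory.IsCompactSimpleLieGroup G → letI : MeasurableSpace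
G := borel G; haveI : BorelSpace G := ⟨rfl⟩; ∀ r :
Literature.MathematicalPhysics.QuantumFieldTheory.LatticeRep G, ∃ (β₀ : ℝ) (m : ℝ → ℝ) (S₀ : ℝ → ℕ),
(∀ β, β₀ ≤ β → 0 < m β) ∧ ∀ A B : Literature.MathematicalPhysics.QuantumFieldTheory.YMSpecies G, ∃ C
: ℝ, ∀ β, β₀ ≤ β → ∀ S : ℕ, S₀ β ≤ S → ∀ n : ℕ, n ≤ S →
|Literature.MathematicalPhysics.QuantumFieldTheory.latticeConnectedCorr r.ρ β (2 * S + 1) A.F B.F n|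
≤ C * Real.exp (-(m β * n))`

## Assembly
Pure logic, checked sorry-free in the planner's Sketch.lean (`fun h1 h2 hglue hclay => hclay (hglue
h1 h2)`, axioms propext/choice/Quot.sound):
the two cruxes give X by TotalCovarianceGlue, and LatticeGapToClay turns X into the summit conjunct.
All mathematics lives in the four antecedents.

Rationale: WHY THIS LINE. The Edwards–Sokal slice identity (EdwardsSokal1988; for q-state Potts GAUGE theory it
is the plaquette random-cluster model of
DuncanSchweinhart2025, arXiv:2308.07534) turns Wilson's weak-coupling measure into an exact mixture
of coupling-free constraint models —
Haar measure conditioned on a random ε-flat tube, the "topological actions" known numerically to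
scale correctly (BietenholzEtAl2010,
AkerlundDeforcrand2015; positive-plaquette precedent MackPietarinen1982,
FingbergHellerMitrjushkin1995; the tube is Lüscher's admissible set,
Luscher1982Topology). Two areas are imported with an explicit dictionary: geometric probability /
isoperimetry of uniform measures on bodies in
a positively curved product G^E (needle decomposition Klartag2017, Bakry–Émery on G^E as in
ShenZhuZhu2023) for the quenched term, and
random-cluster technology (FKG/Holley monotonicity FortuinKasteleynGinibre1971, Holley1974,
Grimmett2006; association covariance bounds
Newman1980; sharpness DuminilCopinRaoufiTassion2019) for the threshold field. The decomposition
Cov_Wilson = E_ρ[Cov_(Haar|Ω_c)] +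
Cov_ρ(E_c·, E_c·) is an identity, so the glue to X is provable now and each crux owns a distinct
toolbox; the abelian exception is excluded by
hypothesis (compact simple G) and located structurally (the U(1) tube is exactly scale-covariant,
card P1). First route on this sub-problem;
the negatives index is empty.

RANKED CRUXES. #0 TubeGapLatticeLeg (target) — X. For every compact simple G
(IsCompactSimpleLieGroup, Borel σ-algebra) and every r : LatticeRep G there exist β₀ : ℝ, m : ℝ → ℝ,
S₀ : ℝ → ℕ with m(β) > 0 for β ≥ β₀ and, for every A, B : YMSpecies G, a constant C with
|latticeConnectedCorr r.ρ β (2S+1) A.F B.F n| ≤ C·exp(−m(β)·n) for all β ≥ β₀, S ≥ S₀(β), n ≤ S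
(Wilson measure on the torus of side 2S+1, connected time-correlation at separation n as in
`HasLatticeMassGap`). Not `LatticeMassGapAllCouplings`: only β ≥ β₀, torus form, simple G; the rate
m is a lower bound on the true mass. (why it might fail: Chatterjee's Problem 5.1(a) at weak
coupling in torus-uniform dress, open for every non-abelian G in d = 4; a faithful reducible r with
bulk first-order endpoints beyond every β₀, or small-torus (toron) effects spoiling C uniform in S ≥
S₀(β), would break this exact shape.) [arXiv180301950, JaffeWitten2000, OsterwalderSeiler1978,
Seiler1982]
#2 QuenchedTubeGapInMean (crux) — K1 of the card, in ρ_β-mean (no adversarial thresholds). Same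
quantifier prefix and data (β₀, m, S₀; ∀ A B ∃ C; β ≥ β₀, S ≥ S₀ β, n ≤ S) as X; on the torus of
side T = 2S+1 put P(U,p) = Re tr r.ρ(U_p), haar = ⊗_edges haarProbability G, tube c = {U | ∀ p, c p
< P U p}, μ_c = ProbabilityTheory.cond haar (tube c) (Haar conditioned on the tube), ρ' = Lebesgue^P
with density ENNReal.ofReal(∏_p β e^(β c_p))·haar(tube c), ρ = ρ'/ρ'(univ) (the Edwards–Sokal
threshold law), a = A.F∘torusLift T, b = B.F∘configShift(−n e₀)∘torusLift T. CLAIM: ∫ |Cov_(μ_c)(a,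
b)| dρ(c) ≤ C·exp(−m(β)·n). Geometric probability: exponential clustering of the UNIFORM measure on
the random ε-flat tube Ω_c ⊂ G^E, uniformly in the volume, on average over the tube. [difficulty:
open-problem] (why it might fail: Ω_c is not geodesically convex where it matters (a convex tube in
Ric ≥ κ_G would give a β-uniform gap, contradicting ξ → ∞); no dimension-free Poincaré theory for
non-convex tubes exists, and ρ_β-typical c is O(1/β)-tight with sparse tighter plaquettes: the
crossover in geometric dress.) [Klartag2017, ShenZhuZhu2023, BietenholzEtAl2010,
Luscher1982Topology, arXiv180301950, FingbergHellerMitrjushkin1995]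
#3 ThresholdDecorrelation (crux) — K2 of the card (annealing), as the second term of the law of
total covariance. Same prefix and `let`-data as QuenchedTubeGapInMean. CLAIM: |∫ (E_(μ_c) a)(E_(μ_c)
b) dρ(c) − (∫ E_(μ_c) a dρ)(∫ E_(μ_c) b dρ)| ≤ C·exp(−m(β)·n): the tube-conditional expectations of
two gauge-invariant local observables decorrelate exponentially under the threshold law ρ_β,
uniformly in the volume. Candidate tools (layer 2, not filed): restricted FKG / association of ρ_β
in the flat corner + Holley coupling in β; Newman-type covariance bounds for associated fields with
quenched sensitivities ∂E_c[a]/∂c_q decaying in dist(q, supp a); spectral gap of the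
constraint-resampling (Swendsen–Wang-type) kernel U → c → U'. [deps: QuenchedTubeGapInMean]
[difficulty: open-problem] (why it might fail: Given QuenchedTubeGapInMean it is equivalent to X (no
free lunch); the FKG lattice condition (log Haar(Ω_c) supermodular) fails at constraint onset in toy
slab models, association of plaquette energies under SU(N) Wilson is unknown, and c is a local
randomisation of U: naive locality is circular.) [EdwardsSokal1988, FortuinKasteleynGinibre1971,
Holley1974, Newman1980, DuncanSchweinhart2025, DuminilCopinRaoufiTassion2019, Grimmett2006]
#4 LatticeGapToClay (crux) — The UV / Osterwalder–Schrader legs, shared with every lattice-first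
line: X → YangMills. Given the volume-uniform lattice gap at all β ≥ β₀ for every compact simple G
and faithful r, produce r, a sequential scheme sch (β_k → ∞, a_k → 0 tied to the physical scale
ξ(β_k) → ∞, L_k ≥ S₀(β_k), a_k L_k → ∞, renormalisations) and OS data T with IsYangMillsFor r sch T
(joint continuum limit of all gauge-invariant Schwinger functions), E0–E4, IsNontrivial and
IsNonGaussian of tr F², T.HasMassGap Δ, and HasLatticeMassGap r sch Δ (the last from X with a_k :=
m(β_k)/Δ once m is matched to the physical rate). Cards: parabolic-renormalised-trajectory,
flow-line-state-space-4d, torus-clause-is-thermal-v2, os-legs-fine-print,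
equipartition-pins-free-gluon-law (ξ → ∞). [deps: TubeGapLatticeLeg] [difficulty: open-problem] (why
it might fail: It is the existence half of the problem: convergence (not just UV stability —
UVStabilityNonUniqueness) of all gauge-invariant Schwinger functions with O(4) invariance,
non-Gaussian tr F², continuum gap; and X's witness rate m is only a lower bound, to be matched to
the physical ξ(β_k) → ∞.) [Balaban1988Convergent, MagnenRivasseauSeneor1993, OsterwalderSeiler1978,
GlimmJaffe1987, JaffeWitten2000]
#9 EdwardsSokalDisintegration (support) — The representation itself (card P1), for every dimension
d, torus side L ≥ 1, compact metrisable group G, continuous matrix representation ρ (faithfulness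
not needed), β > 0 and bounded measurable F: with P, haar, tube, ρ' as above (on GaugeConfig d L G),
0 < ρ'(univ) < ∞ and ∫ F d(wilsonMeasure ρ β) = ∫ ( ∫ F d cond haar (tube c) ) d(ρ'/ρ'(univ))(c).
Proof: Fubini/Tonelli for the joint density ∏_p βe^(βc_p)·1[c_p < P_p(U)] on haar ⊗ Lebesgue^P;
∫_(−∞)^(P) βe^(βc) dc = e^(βP); e^(βΣ_p P_p) = e^(βN·#P)·e^(−β·wilsonAction); where haar(tube c) = 0
both sides vanish (cond of a null set is the zero measure). Wanted as the lemma behind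
TotalCovarianceGlue; a prover may first land the `let` objects as route-posited definitions
(Theorems/RandomConstraintAnnealingDefs.lean). [difficulty: provable-now] [EdwardsSokal1988,
Grimmett2006, Wilson1974]
#9 TotalCovarianceGlue (support) — QuenchedTubeGapInMean → ThresholdDecorrelation →
TubeGapLatticeLeg. For each G, r take β₀ = max(β₀¹, β₀², 1), m = min(m¹, m²), S₀ = max(S₀¹, S₀²), C
= C¹ + C²; by EdwardsSokalDisintegration (instances T2Space/SecondCountableTopology G come from the
closed embedding r.ρ, as in LatticeRep.curvature) applied to F = a·b, a, b, latticeConnectedCorr = ∫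
Cov_(μ_c)(a,b) dρ + [∫ (E_c a)(E_c b) dρ − (∫ E_c a dρ)(∫ E_c b dρ)] (law of total covariance);
finish with |∫ Cov_c dρ| ≤ ∫ |Cov_c| dρ and e^(−m n) ≤ e^(−mⁱ n). [difficulty: provable-now]
[EdwardsSokal1988, Grimmett2006]

TWO-LAYER PLAN. Foreseen glued splits (k ≤ 3, depth 1), filed only after a crux moves:
QuenchedTubeGapInMean ⇐ HomogeneousTubeGap (volume-uniform clustering of
Haar|Ω_ε for CONSTANT thresholds ε in the window ε ≍ κ/β — the topological-action gap) →
SparseTightComparison (ρ_β-typical c = homogeneous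
window + sparse tighter/looser plaquettes, large-field bookkeeping) → QuenchedTubeGapInMean.
ThresholdDecorrelation ⇐ CornerMonotonicity
(restricted FKG / association of ρ_β near the flat corner, or a spectral gap of the
constraint-resampling kernel) → SensitivityDecay (∂E_c[a]/∂c_q
decays in dist(q, supp a), a quenched statement) → ThresholdDecorrelation (Newman-type covariance
bound). LatticeGapToClay ⇐ ExistenceAlongTrajectory
(other cards) → OSAndGapInheritance (torus-clause-is-thermal-v2, os-legs-fine-print) →
LatticeGapToClay.

KILL CRITERIA. Refutation of TubeGapLatticeLeg (a compact simple G and faithful r with no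
volume-uniform gap at arbitrarily large β) closes the route
`refuted:TubeGapLatticeLeg` and sinks every lattice-first line with it. Refutation of
QuenchedTubeGapInMean (quenched non-decay in ρ_β-mean for a
simple G at large β) closes the route: the tube picture is wrong, census to the card. Refutation of
ThresholdDecorrelation alone forces ONE pivot:
replace the total-covariance split by the telescoping over the constraint-resampling kernel K
(Cov_W(A,B_n) = Σ_j E_ρ Cov_c(A, K^j B_n) + tail),
i.e. restate rank 3 as a spectral-gap statement for K; if that is refuted too, close. A proof of X
by any other route moots ranks 2–3 and leaves
LatticeGapToClay as the shared remainder. Numerical kill (kit, hours): for SU(2) on 8⁴ at β ∈ {2.3,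
2.5} the quenched term E_ρ|Cov_c(P_0,P_n)|
and the annealed term must both decay at rates comparable to the full Wilson covariance; large
cancellations between the two terms mean the
split is ill-conditioned and ranks 2–3 are the wrong cruxes (retire to the card).

NOT DECOMPOSED YET. The sparse-tight-plaquette (large-field) bookkeeping of the threshold field; the
homogeneous topological-action gap as a named sub-crux; reflection
positivity of the joint (U, c) law (card P2 — not needed for X as stated, which is torus clustering,
and open per reflection type); the U(1)
scale-covariance lemma (card P1, calibration only); the entropic beta function / scale-covariance
defect (card K3, a computation); the constants
ε₀(G), κ, and the matching of m(β) to the physical ξ(β) (inside LatticeGapToClay). All are layer-2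
children or ride with `--supports`.

CHEAPEST FALSIFIER. Two cheap checks, neither run here (plancard is one-shot, no kit in the
payload): (i) exact/Monte-Carlo test of the FKG lattice condition for
c ↦ log Haar(Ω_c) on one 2⁴ torus for SU(2) at tightness N − c ∈ {0.05, 0.2, 0.5} — a toy slab
computation (log(4st − (s+t−1)²) has a NEGATIVE
mixed partial at onset s = t = 0.6, positive at 0.8) predicts failure at constraint onset, which
kills tool (a) of ThresholdDecorrelation but not
the crux; (ii) the two-term Monte-Carlo of § Kill criteria, which kills the crux split itself.
Literature check already done: the discrete case
(Z_q) of the representation is DuncanSchweinhart2025's plaquette random-cluster model, whose large-β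
phase is Higgs/perimeter (consistent with
DiscreteSubgroupFreezing, no contradiction with X for connected G).

NUMBERS. Strong-coupling Bakry–Émery regime on SU(N)^E: |β| < 1/(16(d−1)) = 1/48 in d = 4
(ShenZhuZhu2023, 't Hooft scaling) — the only proved
functional-inequality gap, far from β ≥ β₀ large. Typical tightness of ρ_β-thresholds: N − c_p = (N
− P_p) + Exp(1)/β = O(1/β). Topological /
constraint actions: asymptotic-freedom scaling of SU(2) observed numerically (BietenholzEtAl2010);
4D U(1) topological action: transition where
monopoles first fit a cube (AkerlundDeforcrand2015); positive-plaquette SU(2) model scales like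
Wilson (FingbergHellerMitrjushkin1995). Items at
open: 7 (target, 3 cruxes, 2 supports, assembly).

DEFINITION REQUESTS. None needed at open: every statement is over existing declarations (LatticeRep,
YMSpecies, latticeConnectedCorr, wilsonMeasure,
haarProbability, plaquetteHolonomy, torusLift, configShift, ProbabilityTheory.cond, Measure.pi,
withDensity) with syntactically identical
`let` blocks. Desirable once a prover claims EdwardsSokalDisintegration: route-posited objects
`tubeSet`, `haarOnTube`, `thresholdLaw`,
`esJoint` in Summits/QuantumFields/YangMills/Theorems/RandomConstraintAnnealingDefs.lean (to be
requested by that prover with --supports).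

CONE STATUS (route-repair gen 3, 2026-08-15). Decl cone clean (80 project constants, 0 unproved;
`closes` native-OK), so nothing in the theses
rests on an unproved fact. The 5 file-level unproved named facts seen by the staffing guardrail all
enter through the gate's base import
Summits.QuantumFields.Statement (they sit in the cone of YangMills/Statement.lean itself; this route
has no imports of its own): 0 imports
droppable, 0 cruxes touch them, nothing restated. needs-fact:
Literature.MathematicalPhysics.QuantumLattice.not_isSimpleCompactGroup_unitaryGroup
(GaugeGroups.lean:266; the only dischargeable one, size S: for card n ≥ 2 the scalar circle U(1)·1 ⊂
U(n) is a proper, non-trivial, closed,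
connected, normal subgroup, and U(1) is abelian for card n = 1; two rc0 candidate `_holds` files are
attached as evidence to
stmt-QuantumFields-9774, to be landed by a literature-prover as
QuantumLattice/GaugeGroupsUnitaryProofs.lean; deliberately NOT filed as an item
of this route, which would pull the constant into the decl cone). Not debt — census hygiene for the
operator (open problems tagged
[status: open], CONVENTIONS §4, never provefact seats):
Literature.MathematicalPhysics.QuantumFieldTheory.ClayYangMillsEuclidean,
ClayYangMillsEuclideanGap, ClayYangMillsEuclideanAlong (YangMillsEuclidean.lean — imported inside
this cone only by YangMillsOS.lean, which names
none of its declarations; the file also hosts three SecondCountableTopology instances, lines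
148–164, that must move with any import drop) and
CaoParkSheffieldProblem (ConstructiveQFTWave0.lean:322; its file carries the lattice vocabulary
GaugeConfig / plaquetteHolonomy / haarProbability /
wilsonMeasure and stays — relocate the def to a leaf file or exclude [status: open] registrations
from module-cone debt). Settled negative, not
debt: Literature.MathematicalPhysics.QuantumLattice.isSpecification_ymSpecification (refuted as
stated by
not_isSpecification_ymSpecification_indiscrete; the corrected isSpecification_ymSpecification_t2 is
discharged). Until the census stops counting
the four [status: open] registrations, every YangMills and QCD route is blocked-by-cone alike and
further repair generations on this route can
change nothing.

Novelty: Searches (2026-08-15; local index exit-75 and OpenAlex/arXiv/S2 HTTP 429 at authoring time, so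
Crossref + zbMATH + galaxy):
`lit search --source crossref "Edwards Sokal lattice gauge theory"` (8, none relevant); `--source
zbmath` same query (1: arXiv:2506.10765, general
Ising couplings); `lit search --source zbmath "topological lattice actions"` (8:
doi:10.1007/jhep12(2010)020); `--source crossref "topological
lattice actions gauge theory"` (8: doi:10.22323/1.251.0169); `--source zbmath "correlation
inequalities lattice gauge theory"` (4: Tomboulis
hep-lat/0209001, nothing on association of plaquettes); `--source zbmath "Griffiths inequalities
gauge theories"` (1, irrelevant); `--source
crossref "cluster algorithm lattice gauge theory auxiliary variables Swendsen Wang"` (8: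
doi:10.1103/physrevd.45.2098 2D U(1) cluster algorithm,
doi:10.22323/1.453.0016); `--source zbmath "random-cluster representation Potts lattice gauge
theory"` (3: doi:10.1016/s0550-3213(00)00459-4,
arXiv:2507.13503, arXiv:2506.10765) and the follow-up author query (4: arXiv:2207.08339 =
DuncanSchweinhart2025, arXiv:2308.07534,
arXiv:2607.02434, arXiv:2507.13503); `lit galaxy search "Edwards-Sokal gauge" --star all` (0); `lit
galaxy search "topological lattice action"
--star all` (1, irrelevant); `lit galaxy search "random cluster representation … gauge" --star pdf`
(8, Potts/RC only); `lit frontier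
QuantumFields --since 2022` (30; no auxiliary-variable representation); the 63 cards of the sub
(ideas.json):  [refs: 10.1007/jhep12(2010, 10.22323/1.251.0169, 10.1103/physrevd.45.2098, 10.22323/1.453.0016, 10.1016/s0550-3213(00, 10.1007/s00220-025-05338-x, 2506.10765, 2507.13503, 2207.08339, 2308.07534, 2607.02434, doi:10.1007/jhep12, doi:10.22323/1.251.0169, doi:10.1103/physrevd.45.2098, doi:10.22323/1.453.0016, doi:10.1016/s0550-3213, doi:10.1007/s00220-025-05338-x, DuncanSchweinhart2025, EdwardsSokal1988, Bie]

Barriers (technique_class: edwards-sokal-random-constraint, flat-tube-geometry): - technique_class: edwards-sokal-random-constraint, flat-tube-geometry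
- Literature.Barriers.QuantumFields.AbelianDeconfinementD4: respected by hypothesis and located
structurally — X and both cruxes quantify over compact SIMPLE G; for U(1) X is false (massless
photon at β > β_c) and the card's P1 shows why in this language (the abelian tube is exactly
scale-covariant), so any argument for QuenchedTubeGapInMean that never uses non-commutativity is
wrong; refuters should run candidate proofs on U(1) first.
- Literature.Barriers.QuantumFields.ZnHiggsPhaseD4: no finite-subgroup stand-in is ever made; for
finite G the representation degenerates to the plaquette random-cluster model
(DuncanSchweinhart2025) whose large-β phase is Higgs/perimeter — visible freezing, consistent with
the barrier, and the reason the statements insist on connected simple G.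
- Literature.Barriers.QuantumFields.FixedCouplingUltralocality: respected — X is the lattice leg
only; the continuum limit is taken inside LatticeGapToClay along β_k → ∞ with a_k tied to the
physical scale ξ(β_k) → ∞, never at fixed coupling.
- Literature.Barriers.QuantumFields.PerturbativeInvisibility: untouched — no expansion in g
anywhere; Haar|Ω_c has no coupling constant and m(β) is never produced by a series.
- Literature.Barriers.QuantumFields.ElitzurTheorem: respected — only gauge-invariant observables
(YMSpecies) are clustered; gauge orbits are part of the tube; nothing is gauge-fixed.
- Literature.Barriers.QuantumFields.UVS

History (route lifecycle, newest last):
- 2026-08-16T17:46:02Z · rev 7: restated Assembly (stmt-QuantumFields-8721) — ground repair: the old Assembly Q → T → TotalCovarianceGlue → LatticeGapToClay → YangMills was a propositional tautology (TotalCovarianceGlue := Q → T → X, Latt (planner-rrepair-QuantumFields-RandomConstraint-ac5104c6-0)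
- 2026-08-23T07:31:55Z · DORMANT — reconciler: no traction for 6 d (last activity statement-grounded at 2026-08-17T07:28:53Z); parked, not closed — `ledger route dormant route-QuantumFields-Rando (operator:999:3411414)
- 2026-08-29T03:33:05Z · REACTIVATED — reconciler: reactivated — activity item-proof-filed at 2026-08-29T01:51:34Z after parking at 2026-08-23T07:31:55Z (operator:999:556381)
- 2026-09-03T10:18:48Z · DORMANT — reconciler: no traction for 5 d (last activity statement-checked at 2026-08-29T09:15:22Z); parked, not closed — `ledger route dormant route-QuantumFields-Random (operator:999:366087)

sub-problem: YangMills · status: dormant · opened planner-plancard-QuantumFields-YangMills-rand-12b92f35-0 2026-08-15T13:28:38Z · rev 7 · ledger route-QuantumFields-RandomConstraintAnnealing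
GENERATED by the gate from the ledger (D-0016/17). Provers cite these decls: `theorem foo : Summit.QuantumFields.YangMills.Theses.RandomConstraintAnnealing.<Decl> := …` in Summits/QuantumFields/YangMills/Theorems/<Name>.lean.
-/

namespace Summit.QuantumFields.YangMills.Theses.RandomConstraintAnnealing

open scoped BigOperators Topology Manifold Classical MeasureTheory ProbabilityTheory Matrix InnerProductSpace ComplexConjugate ContinuousMap
open Filter Set Function TopologicalSpace MeasureTheory

attribute [summit_statement] _root_.YangMills

/-- item stmt-QuantumFields-8715 · target · rank 0 · open · by planner
why it might fail: Chatterjee's Problem 5.1 (mass-gap half) at weak coupling in torus-uniform dress, open for every non-abelian G in d = 4; a faithful reducible r with bulk first-order endpoints beyond every β₀, or toron/zero-mode effects spoiling ONE C for all S ≥ S₀(β), n ≤ S, would break this exact shape.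
sources: arXiv180301950, JaffeWitten2000, OsterwalderSeiler1978, Seiler1982
[target] X. For every compact simple G (IsCompactSimpleLieGroup, Borel σ-algebra) and every r :
LatticeRep G there exist β₀ : ℝ, m : ℝ → ℝ, S₀ : ℝ → ℕ with m(β) > 0 for β ≥ β₀ and, for every A, B
: YMSpecies G, a constant C with |latticeConnectedCorr r.ρ β (2S+1) A.F B.F n| ≤ C·exp(−m(β)·n) for
all β ≥ β₀, S ≥ S₀(β), n ≤ S (Wilson measure on the torus of side 2S+1, connected time-correlation
at separation n as in `HasLatticeMassGap`). Not `LatticeMassGapAllCouplings`: only β ≥ β₀, torus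
form, simple G; the rate m is a lower bound on the true mass. -/
@[route_item "route-QuantumFields-RandomConstraintAnnealing"]
def TubeGapLatticeLeg : Prop :=
  ∀ (G : Type) [Group G] [TopologicalSpace G] [IsTopologicalGroup G] [CompactSpace G], Literature.MathematicalPhysics.QuantumFieldTheory.IsCompactSimpleLieGroup G → letI : MeasurableSpace G := borel G; haveI : BorelSpace G := ⟨rfl⟩; ∀ r : Literature.MathematicalPhysics.QuantumFieldTheory.LatticeRep G, ∃ (β₀ : ℝ) (m : ℝ → ℝ) (S₀ : ℝ → ℕ), (∀ β, β₀ ≤ β → 0 < m β) ∧ ∀ A B : Literature.MathematicalPhysics.QuantumFieldTheory.YMSpecies G, ∃ C : ℝ, ∀ β, β₀ ≤ β → ∀ S : ℕ, S₀ β ≤ S → ∀ n : ℕ, n ≤ S → |Literature.MathematicalPhysics.QuantumFieldTheory.latticeConnectedCorr r.ρ β (2 * S + 1) A.F B.F n| ≤ C * Real.exp (-(m β * n))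

/-- item stmt-QuantumFields-8716 · crux · rank 2 · open · by planner
why it might fail: Not implied by X: |Cov_(Haar|Ω_c)| sits inside the ρ_β-mean, so quenched long-range order on typical O(1/β)-thin, non-convex tubes (cancelling only against the annealed term) refutes it with X intact; no dimension-free Poincaré theory off convexity; weak-coupling decay is proved for finite G only.
sources: Klartag2017, ShenZhuZhu2023, AdhikariCao2025, BietenholzEtAl2010, Luscher1982Topology, arXiv180301950
[crux] K1 of the card, in ρ_β-mean (no adversarial thresholds). Same quantifier prefix and data (β₀,
m, S₀; ∀ A B ∃ C; β ≥ β₀, S ≥ S₀ β, n ≤ S) as X; on the torus of side T = 2S+1 put P(U,p) = Re tr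
r.ρ(U_p), haar = ⊗_edges haarProbability G, tube c = {U | ∀ p, c p < P U p}, μ_c =
ProbabilityTheory.cond haar (tube c) (Haar conditioned on the tube), ρ' = Lebesgue^P with density
ENNReal.ofReal(∏_p β e^(β c_p))·haar(tube c), ρ = ρ'/ρ'(univ) (the Edwards–Sokal threshold law), a =
A.F∘torusLift T, b = B.F∘configShift(−n e₀)∘torusLift T. CLAIM: ∫ |Cov_(μ_c)(a, b)| dρ(c) ≤
C·exp(−m(β)·n). Geometric probability: exponential clustering of the UNIFORM measure on the random
ε-flat tube Ω_c ⊂ G^E, uniformly in the volume, on average over the tube. [difficulty: open-problem] -/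
@[route_item "route-QuantumFields-RandomConstraintAnnealing"]
def QuenchedTubeGapInMean : Prop :=
  ∀ (G : Type) [Group G] [TopologicalSpace G] [IsTopologicalGroup G] [CompactSpace G], Literature.MathematicalPhysics.QuantumFieldTheory.IsCompactSimpleLieGroup G → letI : MeasurableSpace G := borel G; haveI : BorelSpace G := ⟨rfl⟩; ∀ r : Literature.MathematicalPhysics.QuantumFieldTheory.LatticeRep G, ∃ (β₀ : ℝ) (m : ℝ → ℝ) (S₀ : ℝ → ℕ), (∀ β, β₀ ≤ β → 0 < m β) ∧ ∀ A B : Literature.MathematicalPhysics.QuantumFieldTheory.YMSpecies G, ∃ C : ℝ, ∀ β, β₀ ≤ β → ∀ S : ℕ, S₀ β ≤ S → ∀ n : ℕ, n ≤ S → let T : ℕ := 2 * S + 1; let P : Literature.MathematicalPhysics.QuantumFieldTheory.GaugeConfig 4 T G → Literature.MathematicalPhysics.QuantumFieldTheory.Plaquette 4 T → ℝ := fun U p => (r.ρ (Literature.MathematicalPhysics.QuantumFieldTheory.plaquetteHolonomy U p.1 p.2.1.1 p.2.1.2)).trace.re; let haar : MeasureTheory.Measure (Literature.MathematicalPhysics.QuantumFieldTheory.GaugeConfig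 4 T G) := MeasureTheory.Measure.pi fun _ => Literature.MathematicalPhysics.QuantumFieldTheory.haarProbability G; let tube : (Literature.MathematicalPhysics.QuantumFieldTheory.Plaquette 4 T → ℝ) → Set (Literature.MathematicalPhysics.QuantumFieldTheory.GaugeConfig 4 T G) := fun c => {U | ∀ p, c p < P U p}; let μ : (Literature.MathematicalPhysics.QuantumFieldTheory.Plaquette 4 T → ℝ) → MeasureTheory.Measure (Literature.MathematicalPhysics.QuantumFieldTheory.GaugeConfig 4 T G) := fun c => ProbabilityTheory.cond haar (tube c); let ρ' : MeasureTheory.Measure (Literature.MathematicalPhysics.QuantumFieldTheory.Plaquette 4 T → ℝ) := (MeasureTheory.Measure.pi fun _ : Literature.MathematicalPhysics.QuantumFieldTheory.Plaquette 4 T => (MeasureTheory.volume : MeasureTheory.Measure ℝ)).withDensity fun c => ENNReal.ofReal (∏ p, β * Real.exp (β * c p)) * haar (tube c); let ρ : MeasureTheory.Measure (Literature.MathematicalPhysics.QuantumFieldTheory.Plaquette 4 T → ℝ) := (ρ' Set.univ)⁻¹ • ρ'; let a : Literature.MathematicalPhysics.QuantumFieldTheory.GaugeConfig 4 T G → ℝ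 := fun U => A.F (Literature.MathematicalPhysics.QuantumLattice.torusLift T U); let b : Literature.MathematicalPhysics.QuantumFieldTheory.GaugeConfig 4 T G → ℝ := fun U => B.F (Literature.MathematicalPhysics.QuantumLattice.configShift (-Pi.single 0 (n : ℤ)) (Literature.MathematicalPhysics.QuantumLattice.torusLift T U)); (∫ c, |(∫ U, a U * b U ∂μ c) - (∫ U, a U ∂μ c) * (∫ U, b U ∂μ c)| ∂ρ) ≤ C * Real.exp (-(m β * n))

/-- item stmt-QuantumFields-8717 · crux · rank 3 · open · by planner
why it might fail: Given QuenchedTubeGapInMean it is equivalent to X (no free lunch); the FKG lattice condition (log Haar(Ω_c) supermodular) fails at constraint onset in toy slab models, association of plaquette energies under SU(N) Wilson is unknown, and c is a local randomisation of U: naive locality is circular.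
sources: EdwardsSokal1988, FortuinKasteleynGinibre1971, Holley1974, Newman1980, DuncanSchweinhart2025, DuminilCopinRaoufiTassion2019
[crux] K2 of the card (annealing), as the second term of the law of total covariance. Same prefix
and `let`-data as QuenchedTubeGapInMean. CLAIM: |∫ (E_(μ_c) a)(E_(μ_c) b) dρ(c) − (∫ E_(μ_c) a dρ)(∫
E_(μ_c) b dρ)| ≤ C·exp(−m(β)·n): the tube-conditional expectations of two gauge-invariant local
observables decorrelate exponentially under the threshold law ρ_β, uniformly in the volume.
Candidate tools (layer 2, not filed): restricted FKG / association of ρ_β in the flat corner +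
Holley coupling in β; Newman-type covariance bounds for associated fields with quenched
sensitivities ∂E_c[a]/∂c_q decaying in dist(q, supp a); spectral gap of the constraint-resampling
(Swendsen–Wang-type) kernel U → c → U'. [deps: QuenchedTubeGapInMean] [difficulty: open-problem] -/
@[route_item "route-QuantumFields-RandomConstraintAnnealing"]
def ThresholdDecorrelation : Prop :=
  ∀ (G : Type) [Group G] [TopologicalSpace G] [IsTopologicalGroup G] [CompactSpace G], Literature.MathematicalPhysics.QuantumFieldTheory.IsCompactSimpleLieGroup G → letI : MeasurableSpace G := borel G; haveI : BorelSpace G := ⟨rfl⟩; ∀ r : Literature.MathematicalPhysics.QuantumFieldTheory.LatticeRep G, ∃ (β₀ : ℝ) (m : ℝ → ℝ) (S₀ : ℝ → ℕ), (∀ β, β₀ ≤ β → 0 < m β) ∧ ∀ A B : Literature.MathematicalPhysics.QuantumFieldTheory.YMSpecies G, ∃ C : ℝ, ∀ β, β₀ ≤ β → ∀ S : ℕ, S₀ β ≤ S → ∀ n : ℕ, n ≤ S → let T : ℕ := 2 * S + 1; let P : Literature.MathematicalPhysics.QuantumFieldTheory.GaugeConfig 4 T G → Literature.MathematicalPhysics.QuantumFieldTheory.Plaquette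 4 T → ℝ := fun U p => (r.ρ (Literature.MathematicalPhysics.QuantumFieldTheory.plaquetteHolonomy U p.1 p.2.1.1 p.2.1.2)).trace.re; let haar : MeasureTheory.Measure (Literature.MathematicalPhysics.QuantumFieldTheory.GaugeConfig 4 T G) := MeasureTheory.Measure.pi fun _ => Literature.MathematicalPhysics.QuantumFieldTheory.haarProbability G; let tube : (Literature.MathematicalPhysics.QuantumFieldTheory.Plaquette 4 T → ℝ) → Set (Literature.MathematicalPhysics.QuantumFieldTheory.GaugeConfig 4 T G) := fun c => {U | ∀ p, c p < P U p}; let μ : (Literature.MathematicalPhysics.QuantumFieldTheory.Plaquette 4 T → ℝ) → MeasureTheory.Measure (Literature.MathematicalPhysics.QuantumFieldTheory.GaugeConfig 4 T G) := fun c => ProbabilityTheory.cond haar (tube c); let ρ' : MeasureTheory.Measure (Literature.MathematicalPhysics.QuantumFieldTheory.Plaquette 4 T → ℝ) := (MeasureTheory.Measure.pi fun _ : Literature.MathematicalPhysics.QuantumFieldTheory.Plaquette 4 T => (MeasureTheory.volume : MeasureTheory.Measure ℝ)).withDensity fun c => ENNReal.ofReal (∏ p, β * Real.exp (β * c p)) *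 haar (tube c); let ρ : MeasureTheory.Measure (Literature.MathematicalPhysics.QuantumFieldTheory.Plaquette 4 T → ℝ) := (ρ' Set.univ)⁻¹ • ρ'; let a : Literature.MathematicalPhysics.QuantumFieldTheory.GaugeConfig 4 T G → ℝ := fun U => A.F (Literature.MathematicalPhysics.QuantumLattice.torusLift T U); let b : Literature.MathematicalPhysics.QuantumFieldTheory.GaugeConfig 4 T G → ℝ := fun U => B.F (Literature.MathematicalPhysics.QuantumLattice.configShift (-Pi.single 0 (n : ℤ)) (Literature.MathematicalPhysics.QuantumLattice.torusLift T U)); |(∫ c, (∫ U, a U ∂μ c) * (∫ U, b U ∂μ c) ∂ρ) - (∫ c, (∫ U, a U ∂μ c) ∂ρ) * (∫ c, (∫ U, b U ∂μ c) ∂ρ)| ≤ C * Real.exp (-(m β * n))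

/-- item stmt-QuantumFields-8718 · crux · rank 4 · open · by planner
why it might fail: Existence half of the problem, now at certified weak coupling (sch.HasWeakCouplingLimit, β_k → ∞; p116790): joint convergence — not mere UV stability — of all gauge-invariant Schwinger functions, O(4), non-Gaussian tr F², continuum gap; X's rate m(β) is only a lower bound, to be matched to 1/ξ(β_k).
sources: Balaban1988Convergent, MagnenRivasseauSeneor1993, OsterwalderSeiler1978, GlimmJaffe1987, JaffeWitten2000, arXiv180301950
[crux] The UV / Osterwalder–Schrader legs, shared with every lattice-first line: X → YangMills.
Given the volume-uniform lattice gap at all β ≥ β₀ for every compact simple G and faithful r,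
produce r, a sequential scheme sch (β_k → ∞, a_k → 0 tied to the physical scale ξ(β_k) → ∞, L_k ≥
S₀(β_k), a_k L_k → ∞, renormalisations) and OS data T with IsYangMillsFor r sch T (joint continuum
limit of all gauge-invariant Schwinger functions), E0–E4, IsNontrivial and IsNonGaussian of tr F²,
T.HasMassGap Δ, and HasLatticeMassGap r sch Δ (the last from X with a_k := m(β_k)/Δ once m is
matched to the physical rate). Cards: parabolic-renormalised-trajectory, flow-line-state-space-4d,
torus-clause-is-thermal-v2, os-legs-fine-print, equipartition-pins-free-gluon-law (ξ → ∞). [deps: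
TubeGapLatticeLeg] [difficulty: open-problem] -/
@[route_item "route-QuantumFields-RandomConstraintAnnealing"]
def LatticeGapToClay : Prop :=
  TubeGapLatticeLeg → YangMills

/-- item stmt-QuantumFields-8720 · crux · rank 9 · closed · proved by Summit.QuantumFields.YangMills.Theorems.RandomConstraintAnnealing.totalCovarianceGlue_proof (prover) · by planner
why it might fail: Provable-now glue, yet it fails AS STATED if the cruxes' let-objects do not disintegrate wilsonMeasure verbatim: tube measurability in the product σ-algebra (second countability of G only via r), cond on haar-null tubes, 0 < ρ'(univ) < ∞, Bochner junk values for a·b; Cⁱ ≥ 0 to be extracted at n = 0.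
sources: EdwardsSokal1988, Grimmett2006, arXiv180301950
[support] QuenchedTubeGapInMean → ThresholdDecorrelation → TubeGapLatticeLeg. For each G, r take β₀
= max(β₀¹, β₀², 1), m = min(m¹, m²), S₀ = max(S₀¹, S₀²), C = C¹ + C²; by EdwardsSokalDisintegration
(instances T2Space/SecondCountableTopology G come from the closed embedding r.ρ, as in
LatticeRep.curvature) applied to F = a·b, a, b, latticeConnectedCorr = ∫ Cov_(μ_c)(a,b) dρ + [∫ (E_c
a)(E_c b) dρ − (∫ E_c a dρ)(∫ E_c b dρ)] (law of total covariance); finish with |∫ Cov_c dρ| ≤ ∫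
|Cov_c| dρ and e^(−m n) ≤ e^(−mⁱ n). [difficulty: provable-now] -/
@[route_item "route-QuantumFields-RandomConstraintAnnealing"]
def TotalCovarianceGlue : Prop :=
  QuenchedTubeGapInMean → ThresholdDecorrelation → TubeGapLatticeLeg

-- `TotalCovarianceGlue` holds: proved by `Summit.QuantumFields.YangMills.Theorems.RandomConstraintAnnealing.totalCovarianceGlue_proof` (its module imports this route file, so no `_holds` link can be stated here).

/-- item stmt-QuantumFields-8719 · support · rank 9 · closed · proved by Summit.QuantumFields.YangMills.Theorems.RandomConstraintAnnealing.edwardsSokalDisintegration_proof (prover) · by planner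
sources: EdwardsSokal1988, Grimmett2006, Wilson1974
[support] The representation itself (card P1), for every dimension d, torus side L ≥ 1, compact
metrisable group G, continuous matrix representation ρ (faithfulness not needed), β > 0 and bounded
measurable F: with P, haar, tube, ρ' as above (on GaugeConfig d L G), 0 < ρ'(univ) < ∞ and ∫ F
d(wilsonMeasure ρ β) = ∫ ( ∫ F d cond haar (tube c) ) d(ρ'/ρ'(univ))(c). Proof: Fubini/Tonelli for
the joint density ∏_p βe^(βc_p)·1[c_p < P_p(U)] on haar ⊗ Lebesgue^P; ∫_(−∞)^(P) βe^(βc) dc =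
e^(βP); e^(βΣ_p P_p) = e^(βN·#P)·e^(−β·wilsonAction); where haar(tube c) = 0 both sides vanish (cond
of a null set is the zero measure). Wanted as the lemma behind TotalCovarianceGlue; a prover may
first land the `let` objects as route-posited definitions
(Theorems/RandomConstraintAnnealingDefs.lean). [difficulty: provable-now] -/
@[route_item "route-QuantumFields-RandomConstraintAnnealing"]
def EdwardsSokalDisintegration : Prop :=
  ∀ (d L N : ℕ) [NeZero L] (G : Type) [Group G] [TopologicalSpace G] [IsTopologicalGroup G] [CompactSpace G] [T2Space G] [SecondCountableTopology G] [MeasurableSpace G] [BorelSpace G] (ρ : G →* Matrix (Fin N) (Fin N) ℂ), Continuous ρ → ∀ β : ℝ, 0 < β → ∀ F : Literature.MathematicalPhysics.QuantumFieldTheory.GaugeConfig d L G → ℝ, Measurable F → (∃ K : ℝ, ∀ U, |F U| ≤ K) → let P : Literature.MathematicalPhysics.QuantumFieldTheory.GaugeConfig d L G → Literature.MathematicalPhysics.QuantumFieldTheory.Plaquette d L → ℝ := fun U p => (ρ (Literature.MathematicalPhysics.QuantumFieldTheory.plaquetteHolonomy U p.1 p.2.1.1 p.2.1.2)).trace.re;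 let haar : MeasureTheory.Measure (Literature.MathematicalPhysics.QuantumFieldTheory.GaugeConfig d L G) := MeasureTheory.Measure.pi fun _ => Literature.MathematicalPhysics.QuantumFieldTheory.haarProbability G; let tube : (Literature.MathematicalPhysics.QuantumFieldTheory.Plaquette d L → ℝ) → Set (Literature.MathematicalPhysics.QuantumFieldTheory.GaugeConfig d L G) := fun c => {U | ∀ p, c p < P U p}; let ρ' : MeasureTheory.Measure (Literature.MathematicalPhysics.QuantumFieldTheory.Plaquette d L → ℝ) := (MeasureTheory.Measure.pi fun _ : Literature.MathematicalPhysics.QuantumFieldTheory.Plaquette d L => (MeasureTheory.volume : MeasureTheory.Measure ℝ)).withDensity fun c => ENNReal.ofReal (∏ p, β * Real.exp (β * c p)) * haar (tube c); (0 < ρ' Set.univ ∧ ρ' Set.univ < ⊤) ∧ ∫ U, F U ∂(Literature.MathematicalPhysics.QuantumFieldTheory.wilsonMeasure ρ β) = ∫ c, (∫ U, F U ∂(ProbabilityTheory.cond haar (tube c))) ∂((ρ' Set.univ)⁻¹ • ρ')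

-- `EdwardsSokalDisintegration` holds: proved by `Summit.QuantumFields.YangMills.Theorems.RandomConstraintAnnealing.edwardsSokalDisintegration_proof` (its module imports this route file, so no `_holds` link can be stated here).

-- earlier Assembly (stmt-QuantumFields-8721, replaced 2026-08-16T17:46:02Z -> stmt-QuantumFields-16156): retired by None — QuenchedTubeGapInMean → ThresholdDecorrelation → TotalCovarianceGlue → LatticeGapToClay → YangMills
/-- item stmt-QuantumFields-16156 · assembly · rank 1 · closed · proved by Summit.QuantumFields.YangMills.Theorems.RandomConstraintAnnealing.assembly_proof (prover) · by planner
sources: JaffeWitten2000, EdwardsSokal1988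
[assembly] The two Edwards–Sokal cruxes and the UV / Osterwalder–Schrader crux imply the summit:
QuenchedTubeGapInMean → ThresholdDecorrelation → LatticeGapToClay → YangMills. Not a tautology (the
law-of-total-covariance split Q → T → X is the content of crux TotalCovarianceGlue); proof once that
item lands: fun h1 h2 hclay => hclay (TotalCovarianceGlue_holds h1 h2). The deciding theorem
`closes` (crux-only, native-certified) is the route glue; this item is the optional cruxes-to-summit
statement. -/
@[route_item "route-QuantumFields-RandomConstraintAnnealing"]
def Assembly : Prop :=
  QuenchedTubeGapInMean → ThresholdDecorrelation → LatticeGapToClay → YangMills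

-- `Assembly` holds: proved by `Summit.QuantumFields.YangMills.Theorems.RandomConstraintAnnealing.assembly_proof` (its module imports this route file, so no `_holds` link can be stated here).

/-! D-0027 §2.1 — DECIDING THEOREM (planner-authored via `route open/edit --closes-file`; by planner-rrepair-QuantumFields-RandomConstraint-ac5104c6-0 2026-08-16T17:38:59Z):
its hypotheses are this route's items and its conclusion the sub-problem Statement (glue_lint), and it elaborates with this file. -/

/-- Deciding theorem (D-0027 §2.1). The route's glue is pure logic: the two Edwards–Sokal cruxes give
the lattice leg `TubeGapLatticeLeg` through `TotalCovarianceGlue` (law of total covariance under the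
threshold law), and `LatticeGapToClay` (the UV / Osterwalder–Schrader legs) turns it into the
sub-problem statement `YangMills` BY NAME — so after the 2026-08-16 re-type (p116790: first conjunct
`sch.HasWeakCouplingLimit`, i.e. `β_k = 2/g₀² → ∞` along the scheme) the weak-coupling conjunct is
supplied inside `LatticeGapToClay`: the lattice leg `TubeGapLatticeLeg` holds at EVERY `β ≥ β₀`
uniformly in the volume, so the scheme built there is free to take any `β_k → ∞` (it always did:
`a_k` is tied to the physical scale `ξ(β_k) → ∞`, never fixed coupling). No Literature fact is used:
the cone of this theorem is the cone of `YangMills` plus the lattice vocabulary (`LatticeRep`,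
`YMSpecies`, `latticeConnectedCorr`, `wilsonMeasure`, `haarProbability`, `plaquetteHolonomy`,
`torusLift`, `configShift`). -/
@[closes "route-QuantumFields-RandomConstraintAnnealing"] theorem closes (h1 : QuenchedTubeGapInMean) (h2 : ThresholdDecorrelation)
    (hglue : TotalCovarianceGlue) (hclay : LatticeGapToClay) : YangMills :=
  hclay (hglue h1 h2)

end Summit.QuantumFields.YangMills.Theses.RandomConstraintAnnealing
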